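/-
Origin: expansion seat `literature-prover-pub-hodgecm-cf-hasseminkowski-g5-0`, handover #2 2026-08-18T06:08:45Z (`HOME/pub-hodgecm-cf-hasseminkowski-g5/handover/HodgeCM/Literature/ClassBaseChange.lean`, md5 7997703c, 221 lines);
landed by the gen-6 packager in gate run 24 as `HodgeCM/Literature/ClassBaseChange.lean` (verbatim).
-/
/-
Origin: CITED-FACT seat (4), unit `pub-hodgecm-cf-hasseminkowski-g5` (session literature-prover-pub-hodgecm-cf-hasseminkowski-g5-0),
HodgeCM publication cell, 2026-08-18.  Intended landing: `HodgeCM/Literature/ClassBaseChange.lean` (after `NormOneCompactHolds.lean` and the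
vendored `HodgeCM/Vendored/H21/NumberTheory/Automorphic/AdeleBaseChange.lean`).
-/
import Summits.HodgeConjecture.HodgeCM.PerL34.ProperBaseChange
import Summits.HodgeConjecture.HodgeCM.Literature.NormOneCompactHolds
import Literature.NumberTheory.Automorphic.AdeleBaseChange

/-!
# The base change `C_K → C_L` of idele class groups IS proper — N15's (INPUT) datum constructed

PerL v5 §3.2, tex ll. 310–311 (node N15): "the closed subgroup `𝔸^×_{L₀}L^×/L^×` (the image of the idele
class group of `L₀`, which injects continuously and properly: norm-one classes are compact and
`|·|_L = |·|²_{L₀}` on `𝔸^×_{L₀}`)".  The expansion seat pv10 proved the inference as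
`ProperBaseChange.isProperMap_baseChange (hK : NormOneIdeleClassesCompact K) {ι : C_K → C_L} (hι : Continuous ι)
(hn : n ≠ 0) (hnorm : ∀ x, logClassNorm L (ι x) = n * logClassNorm K x) : IsProperMap ι`, leaving TWO inputs:
(PRINT-1) `hK` — discharged in `NormOneCompactHolds.lean` — and (INPUT) the datum `ι` with its norm identity
("adelic base change along `L/L₀` is absent from Mathlib").  This file CONSTRUCTS `ι` and PROVES the norm identity:

* `NumberField.classBaseChange K L : IdeleClassGroup K →* IdeleClassGroup L`, induced by the adelic base change
  `𝔸_K → 𝔸_L`, `x ↦ x ⊗ 1` (the harness21 Literature library's `Literature.NumberTheory.Automorphic.AdeleRing.baseChange`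
  / `ideleBaseChange`, file `AdeleBaseChange.lean`, Mathlib-only, everything proved there: componentwise
  `K_v → L_w` for `w ∣ v`; Cassels–Fröhlich Ch. II §14), which maps principal ideles to principal ideles
  (`AdeleRing.baseChange_algebraMap`); continuous (`continuous_classBaseChange`).
* **`logClassNorm_classBaseChange`**: `log |ι c|_L = ([L:ℚ]/[K:ℚ]) · log |c|_K`, and `logClassNorm_classBaseChange'`:
  `= [L:K] · log |c|_K` (tower law) — PerL's "`|·|_L = |·|²_{L₀}`" for `[L:L₀] = 2`.
  PROOF WITHOUT local ramification bookkeeping: every class is `expClass K s · c₁` with `c₁ ∈ C¹_K` (pv10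
  `ClassNormProper.exists_expClass_mul_normOne`); (i) `ι (expClass K s) = expClass L s` because `K_v → L_w` is a
  continuous ring map and so fixes the canonical copy of `ℝ` (two continuous ring maps `ℝ → L_w` agree: they agree
  on `ℚ`), whence `log|ι(expClass K s)|_L = [L:ℚ]·s` while `log|expClass K s|_K = [K:ℚ]·s` (pv10 `logClassNorm_expClass`,
  Mathlib `InfinitePlace.sum_mult_eq`); (ii) `log|ι c₁|_L = 0` for `c₁ ∈ C¹_K` because `C¹_K` is COMPACT
  (`normOneIdeleClassesCompact_holds`, the vendored Cassels–Fröhlich II §16 theorem), so `log|ι(·)|_L` maps it onto a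
  compact = bounded subgroup of `(ℝ,+)`, which is `{0}`.
* **`isProperMap_classBaseChange`**, **`isClosed_range_classBaseChange`**: pv10's `isProperMap_baseChange` /
  `isClosed_range_baseChange` with BOTH inputs supplied — tex ll. 310–311 ("injects continuously and properly",
  as used: the image is closed) is KERNEL for the actual base-change map, for every extension of number fields
  `L/K` (`K L : Type`).  Injectivity of `C_K → C_L` (`𝕀_K ∩ L^× = K^×`) is not needed by the N15 capstone
  `N15Existence.exists_unitaryHeckeCharacter_of_isProperMap` (it takes `IsProperMap f` only) and is not proved here.

References: J. W. S. Cassels, A. Fröhlich (eds.), *Algebraic Number Theory* (1967), Ch. II §14 (adeles under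
base change), §16 THEOREM p. 121 (compactness of `J_k^1/k^×`); A. Weil, *Basic Number Theory* IV §4.
No PerL/QW8/2001 statement is used; no named fact is introduced; everything below is proved.
-/

set_option autoImplicit false

noncomputable section

open NumberField InfinitePlace

namespace NumberField

open Literature.NumberTheory Literature.NumberTheory.Automorphic

variable (K L : Type) [Field K] [NumberField K] [Field L] [NumberField L] [Algebra K L]

namespace ClassBaseChange

/-! ### §0 Two continuous ring maps out of `ℝ` agree -/

/-- Two continuous ring homomorphisms `ℝ → R` into a Hausdorff division ring coincide (they agree on
the dense subfield `ℚ`). -/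
theorem ringHom_real_eq {R : Type*} [DivisionRing R] [TopologicalSpace R] [T2Space R]
    {f g : ℝ →+* R} (hf : Continuous f) (hg : Continuous g) : f = g := by
  refine RingHom.ext fun r => congrFun (Rat.denseRange_cast.equalizer hf hg ?_) r
  funext q
  simp only [Function.comp_apply, map_ratCast]

/-! ### §1 Principal ideles go to principal ideles -/

/-- `(k)_{𝔸_K} ↦ (k)_{𝔸_L}` (`AdeleRing.baseChange_algebraMap`). -/
theorem ideleBaseChange_mem_principalIdeles {x : ideleGroup K} (hx : x ∈ principalIdeles K) :
    AdeleRing.ideleBaseChange K L x ∈ principalIdeles L := by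
  obtain ⟨k, rfl⟩ := hx
  refine ⟨Units.map (algebraMap K L).toMonoidHom k, Units.ext ?_⟩
  rw [Units.coe_map, AdeleRing.coe_ideleBaseChange, Units.coe_map]
  exact (AdeleRing.baseChange_algebraMap K L (k : K)).symm

/-- (Ported verbatim from the HodgeCMPerL package; no docstring in the source.) -/
theorem principalIdeles_le_comap :
    principalIdeles K ≤ (principalIdeles L).comap (AdeleRing.ideleBaseChange K L) :=
  fun _ hx => ideleBaseChange_mem_principalIdeles K L hx

end ClassBaseChange

/-- **The base change of idele classes** `ι : C_K →* C_L` induced by `𝔸_K → 𝔸_L`, `x ↦ x ⊗ 1`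
(PerL v5 l. 310: "the image of the idele class group of `L₀`" is `Set.range (classBaseChange L₀ L)`). -/
def classBaseChange : IdeleClassGroup K →* IdeleClassGroup L :=
  QuotientGroup.map (principalIdeles K) (principalIdeles L) (AdeleRing.ideleBaseChange K L)
    (ClassBaseChange.principalIdeles_le_comap K L)

/-- (Ported verbatim from the HodgeCMPerL package; no docstring in the source.) -/
theorem classBaseChange_mk (x : ideleGroup K) :
    classBaseChange K L (QuotientGroup.mk x) = QuotientGroup.mk (AdeleRing.ideleBaseChange K L x) := rfl

/-- `ι` is continuous (PerL l. 311 "injects continuously"). -/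
theorem continuous_classBaseChange : Continuous (classBaseChange K L) := by
  refine (QuotientGroup.isQuotientMap_mk (principalIdeles K)).continuous_iff.mpr ?_
  exact QuotientGroup.continuous_mk.comp (Continuous.units_map _ (AdeleRing.continuous_baseChange K L))

namespace ClassBaseChange

/-! ### §2 The rays `expClass` are preserved -/

omit [NumberField K] [NumberField L] in
/-- `K_v → L_w` fixes the canonical copy of `ℝ`: `ℝ → K_v → L_w` and `ℝ → L_w` are continuous ring maps. -/
theorem infiniteCompletionOfComap_realToCompletion (w : InfinitePlace L) (r : ℝ) :
    infiniteCompletionOfComap K L w (realToCompletion K (w.comap (algebraMap K L)) r) =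
      realToCompletion L w r := by
  have h : (infiniteCompletionOfComap K L w).comp (realToCompletion K (w.comap (algebraMap K L))) =
      realToCompletion L w :=
    ringHom_real_eq ((continuous_infiniteCompletionOfComap K L w).comp (continuous_realToCompletion K _))
      (continuous_realToCompletion L w)
  exact RingHom.congr_fun h r

omit [NumberField K] [NumberField L] in
/-- The base change of `(e^s)_v ∈ K_∞` is `(e^s)_w ∈ L_∞`. -/
theorem baseChange_expLine (s : ℝ) :
    InfiniteAdeleRing.baseChange K L (expLine K s : InfiniteAdeleRing K) = (expLine L s : InfiniteAdeleRing L) := by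
  funext w
  rw [InfiniteAdeleRing.baseChange_apply, expLine_apply, expLine_apply,
    infiniteCompletionOfComap_realToCompletion]

/-- (Ported verbatim from the HodgeCMPerL package; no docstring in the source.) -/
theorem coe_infUnitsToIdele (u : (InfiniteAdeleRing K)ˣ) :
    ((infUnitsToIdele K u : ideleGroup K) : AdeleRing (𝓞 K) K) = ((u : InfiniteAdeleRing K), 1) := rfl

/-- (Ported verbatim from the HodgeCMPerL package; no docstring in the source.) -/
theorem ideleBaseChange_infUnitsToIdele_expLine (s : ℝ) :
    AdeleRing.ideleBaseChange K L (infUnitsToIdele K (expLine K s)) = infUnitsToIdele L (expLine L s) := by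
  refine Units.ext ?_
  rw [AdeleRing.coe_ideleBaseChange, coe_infUnitsToIdele, coe_infUnitsToIdele]
  refine Prod.ext ?_ ?_
  · rw [AdeleRing.baseChange_fst, baseChange_expLine]
  · rw [AdeleRing.baseChange_snd, map_one]

/-- `ι (expClass K s) = expClass L s`. -/
theorem classBaseChange_expClass (s : ℝ) : classBaseChange K L (expClass K s) = expClass L s := by
  show classBaseChange K L (QuotientGroup.mk (infUnitsToIdele K (expLine K s))) =
    QuotientGroup.mk (infUnitsToIdele L (expLine L s))
  rw [classBaseChange_mk, ideleBaseChange_infUnitsToIdele_expLine]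

/-! ### §3 Norm-one classes go to norm-one classes (compactness of `C¹_K`) -/

/-- `log |ι c₁|_L = 0` for `c₁ ∈ C¹_K`: `c ↦ log|ι c|_L` is a continuous homomorphism to `(ℝ, +)`, so it
maps the COMPACT group `C¹_K` onto a bounded subgroup of `ℝ`, i.e. onto `{0}`. -/
theorem logClassNorm_classBaseChange_eq_zero_of_mem {c : IdeleClassGroup K}
    (hc : c ∈ normOneIdeleClasses K) : logClassNorm L (classBaseChange K L c) = 0 := by
  set f : IdeleClassGroup K → ℝ := fun c => logClassNorm L (classBaseChange K L c) with hf
  have hf_mul : ∀ a b, f (a * b) = f a + f b := fun a b => by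
    simp only [hf, map_mul, logClassNorm_mul]
  have hf_one : f 1 = 0 := by
    simp only [hf, map_one, logClassNorm, Units.val_one, Real.log_one]
  have hf_pow : ∀ (a : IdeleClassGroup K) (k : ℕ), f (a ^ k) = (k : ℝ) * f a := by
    intro a k
    induction k with
    | zero => rw [pow_zero, hf_one, Nat.cast_zero, zero_mul]
    | succ k ih => rw [pow_succ, hf_mul, ih, Nat.cast_succ]; ring
  have hcont : Continuous f := (continuous_logClassNorm L).comp (continuous_classBaseChange K L)
  have hC : IsCompact (normOneIdeleClasses K : Set (IdeleClassGroup K)) := normOneIdeleClassesCompact_holds K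
  have hS : IsCompact (f '' (normOneIdeleClasses K : Set (IdeleClassGroup K))) := hC.image hcont
  obtain ⟨M, hM⟩ := hS.bddAbove
  obtain ⟨m, hm⟩ := hS.bddBelow
  have hk : ∀ k : ℕ, (k : ℝ) * f c ∈ f '' (normOneIdeleClasses K : Set (IdeleClassGroup K)) :=
    fun k => ⟨c ^ k, pow_mem hc k, hf_pow c k⟩
  show f c = 0
  by_contra h
  rcases lt_or_gt_of_ne h with hneg | hpos
  · obtain ⟨k, hk'⟩ := exists_nat_gt (m / f c)
    have h1 : (k : ℝ) * f c < m := (div_lt_iff_of_neg hneg).mp hk'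
    exact absurd (hm (hk k)) (not_le.mpr h1)
  · obtain ⟨k, hk'⟩ := exists_nat_gt (M / f c)
    have h1 : M < (k : ℝ) * f c := (div_lt_iff₀ hpos).mp hk'
    exact absurd (hM (hk k)) (not_le.mpr h1)

end ClassBaseChange

/-! ### §4 The norm identity and properness -/

open ClassBaseChange in
/-- **`log |ι c|_L = ([L:ℚ]/[K:ℚ]) · log |c|_K`** for every idele class `c` of `K`. -/
theorem logClassNorm_classBaseChange (c : IdeleClassGroup K) :
    logClassNorm L (classBaseChange K L c) =
      (Module.finrank ℚ L : ℝ) / (Module.finrank ℚ K : ℝ) * logClassNorm K c := by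
  have hK : (Module.finrank ℚ K : ℝ) ≠ 0 := by exact_mod_cast (Module.finrank_pos (R := ℚ) (M := K)).ne'
  obtain ⟨c₁, hc₁, hc⟩ := exists_expClass_mul_normOne K c
  have h : logClassNorm L (classBaseChange K L c) =
      (Module.finrank ℚ L : ℝ) * (logClassNorm K c / (Module.finrank ℚ K : ℝ)) := by
    conv_lhs => rw [hc]
    rw [map_mul, logClassNorm_mul, classBaseChange_expClass, logClassNorm_expClass,
      logClassNorm_classBaseChange_eq_zero_of_mem K L hc₁, add_zero]
  rw [h]
  field_simp

/-- The same identity with the exponent `[L:K]` (tower law): `log |ι c|_L = [L:K] · log |c|_K`, i.e.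
`|ι x|_L = |x|_K^{[L:K]}` — PerL's "`|·|_L = |·|²_{L₀}`" for the quadratic `L/L₀`. -/
theorem logClassNorm_classBaseChange' (c : IdeleClassGroup K) :
    logClassNorm L (classBaseChange K L c) = (Module.finrank K L : ℝ) * logClassNorm K c := by
  have hK : (Module.finrank ℚ K : ℝ) ≠ 0 := by exact_mod_cast (Module.finrank_pos (R := ℚ) (M := K)).ne'
  rw [logClassNorm_classBaseChange, ← Module.finrank_mul_finrank ℚ K L, Nat.cast_mul]
  field_simp

omit [Algebra K L] in
/-- (Ported verbatim from the HodgeCMPerL package; no docstring in the source.) -/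
theorem finrank_div_finrank_ne_zero :
    (Module.finrank ℚ L : ℝ) / (Module.finrank ℚ K : ℝ) ≠ 0 :=
  div_ne_zero (by exact_mod_cast (Module.finrank_pos (R := ℚ) (M := L)).ne')
    (by exact_mod_cast (Module.finrank_pos (R := ℚ) (M := K)).ne')

/-- **`ι : C_K → C_L` is a proper map** (PerL v5 l. 311 "injects continuously and properly"): pv10's
`isProperMap_baseChange` with `hK := normOneIdeleClassesCompact_holds K` (Cassels–Fröhlich II §16) and the
norm identity `logClassNorm_classBaseChange`. -/
theorem isProperMap_classBaseChange : IsProperMap (classBaseChange K L) :=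
  isProperMap_baseChange K L (normOneIdeleClassesCompact_holds K) (continuous_classBaseChange K L)
    (finrank_div_finrank_ne_zero K L) (logClassNorm_classBaseChange K L)

/-- **The image of `C_K` in `C_L` is closed** (PerL v5 ll. 309–310: "`B` is closed, being the product of the
closed subgroup `𝔸^×_{L₀}L^×/L^×` (the image of the idele class group of `L₀` …)"). -/
theorem isClosed_range_classBaseChange : IsClosed (Set.range (classBaseChange K L)) :=
  isClosed_range_baseChange K L (normOneIdeleClassesCompact_holds K) (continuous_classBaseChange K L)
    (finrank_div_finrank_ne_zero K L) (logClassNorm_classBaseChange K L)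

end NumberField

end
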